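import Mathlib.NumberTheory.EllipticDivisibilitySequence
import Mathlib.Algebra.Ring.Divisibility.Basic
import Mathlib.Tactic.FieldSimp
import Mathlib.Tactic.IntervalCases
import Mathlib.Tactic.LinearCombination
import HarnessLib

/-!
# Ward's symmetry (periodicity) theorem for elliptic nets over a field

Topic `NumberTheory/EllipticCurves`; companion to `EllipticNet.lean` (normalised EDSs and division
polynomials are elliptic nets). Let `W : ℤ → K` be an elliptic net over a field (all elliptic
relators `ER(p, q, r, s)` vanish, Mathlib's `IsEllipticNet W`), odd, with `W 1 = 1`, and let
`d ≥ 3` be an index with `W d = 0` and `W j ≠ 0` for `0 < j < d` (a *rank of apparition*).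
The **symmetry formula** (Ward 1948, for integral EDSs; Silverman, *AEC*, Exercise 3.35(f), for
the EDS `n ↦ ψₙ(P)` of a torsion point, in the form `W_{ri+j} = W_j A^{ij} B^{i²}`) says that there
are nonzero constants `α, β` with

`W (d + n) = α βⁿ W n` for all `n ∈ ℤ`, and `α² = β^d`

(iterate to get Silverman's form with `A = β`, `B = α`).

We prove this here (`Literature.NumberTheory.EllipticCurves.EllipticNet.exists_periodic`) directly from the elliptic relations, for
elliptic *nets* over any field, under the two extra hypotheses that are needed in this generality:
`W (d + 1) ≠ 0`, and, when `d = 3`, `W 4 = -W 2 ^ 5` (for `d = 3` the net relations alone do not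
force periodicity: `normEDS b 0 d'` is an elliptic net with `W 3 = 0` for every `d'`, and it is
periodic iff `d' = -b⁴`; for `d ≥ 4` the second hypothesis is vacuous and the first is automatic
in the cases of interest). Both hypotheses hold for the values `n ↦ ψₙ(P)` of the division
polynomials at a point of order `d` of an elliptic curve (they follow from the group law by
induction), which is the application in `MultiplicationByN.lean` (Silverman, *AEC*, Exercise
3.7(d): the multiplication-by-`n` formula).

We also record the degenerate case `W 2 = 0` of a normalised EDS (`normEDS 0 c d`, the case of a
`2`-torsion point): all even-indexed terms vanish and, over a domain with `c ≠ 0`, no odd-indexed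
term does (`Literature.NumberTheory.EllipticCurves.EllipticNet.normEDS_even_eq_zero`, `normEDS_odd_ne_zero`).

## Proof sketch (`exists_periodic`)

Write `u = W (d+1)`, `v = W (d-1)`, `b = W 2`, `w = W (d+2)`. From `ER(p, d, r, s) = 0` and
`W d = 0`: `W(p+d+s) W(p-d) W(r+s) W(r) = W(r+d+s) W(r-d) W(p+s) W(p)` (`rel_shift`), and from
`ER(q+d, q, r, s) = 0`: `W(q+d+r+s) W(q+d-r) W(q+s) W(q) = W(q+r+s) W(q-r) W(q+d+s) W(q+d)`
(`rel_shift'`). Instances: `w W(d-2) = u v b²`, `v w² = -u³ b²` (for `d ≥ 4` via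
`v W(d+3) = -u² W 3` and `W 3 · w² = b² u W(d+3)`; for `d = 3` from `W 4 = -W 2⁵`). Put
`β = w / (u b)`, `α = u² b / w`; then `α β = u`, `α β² b = w`, `α = -v β`. The relations
`v W(k) W(j) W(d+n) = -W(d+j) W(d+k) W(n)` (`k + j = n - 1`) give `W (d+n) = α βⁿ W n` for
`n ≥ 0` by strong induction (choosing `(k, j) = (1, n-2)` or `(2, n-3)` with `W k, W j ≠ 0`, the
zero set below `d + n` being known inductively), the mirror relations give `W (d-n) βⁿ = -α W n`,
and `W(2d+1) = -u³ v` gives `α² = β^d`.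

## References

* [SilvermanAEC2009] J. H. Silverman, *The Arithmetic of Elliptic Curves*, 2nd ed., GTM 106,
  Springer 2009: Exercise 3.34 (elliptic divisibility sequences, rank of apparition),
  Exercise 3.35(f) (the symmetry formula `W_{ri+j} = W_j A^{ij} B^{i²}`), Exercise 3.7 (division
  polynomials); pp. 107–108 and 97–98 of the held text.
* [Ward1948] M. Ward, *Memoir on elliptic divisibility sequences*, Amer. J. Math. 70 (1948),
  31–74 (the original source of the symmetry formula; not held, cited for provenance only).
* [Xu2026] Junyan Xu, *On elliptic sequences over commutative rings*, arXiv:2604.05280, §1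
  (elliptic nets, the relators `ER`).

## Design

Everything lives in `namespace Literature.EllipticNet` (helper namespace of `EllipticNet.lean`), with
Mathlib's `IsEllipticNet.rel` opened. Hypotheses are explicit arguments (no bundled structure):
the application supplies them from an induction hypothesis. Exponents inside the inductions are
natural numbers; the packaged statement uses `zpow`.
-/

universe u

open IsEllipticNet

namespace Literature.NumberTheory.EllipticCurves

namespace EllipticNet

/-! ## Two families of three-term relations at a zero of the net -/

section Ring

variable {R : Type u} [CommRing R] {W : ℤ → R}

/-- If `W` is an elliptic net over a domain then `W 0 = 0` (`ER(0,0,0,0) = W(0)⁴`). [folklore] -/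
theorem apply_zero_eq_zero [IsReduced R] (net : IsEllipticNet W) : W 0 = 0 := by
  have h := net 0 0 0 0
  simp only [rel, add_zero, sub_zero] at h
  have h4 : W 0 ^ 4 = 0 := by linear_combination h
  exact IsReduced.eq_zero _ ⟨4, h4⟩

/-- **Shifted relations at a zero, first family.** If `W` is an odd elliptic net and `W d = 0`,
then `ER(p, d, r, s) = 0` reads `W(p+d+s) W(p-d) W(r+s) W(r) = W(r+d+s) W(r-d) W(p+s) W(p)`.
[folklore] -/
theorem rel_shift (net : IsEllipticNet W) (odd : Function.Odd W) {d : ℤ} (hd : W d = 0)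
    (p r s : ℤ) :
    W (p + d + s) * W (p - d) * W (r + s) * W r = W (r + d + s) * W (r - d) * W (p + s) * W p := by
  have h := net p d r s
  have e1 : W (d + r + s) = W (r + d + s) := by congr 1; ring
  have e2 : W (d - r) = -W (r - d) := by rw [← odd (r - d)]; congr 1; ring
  rw [rel, hd, e1, e2] at h
  linear_combination h

/-- **Shifted relations at a zero, second family.** If `W` is an elliptic net and `W d = 0`, then
`ER(q+d, q, r, s) = 0` reads `W(q+d+r+s) W(q+d-r) W(q+s) W(q) = W(q+r+s) W(q-r) W(q+d+s) W(q+d)`.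
[folklore] -/
theorem rel_shift' (net : IsEllipticNet W) {d : ℤ} (hd : W d = 0) (q r s : ℤ) :
    W (q + d + r + s) * W (q + d - r) * W (q + s) * W q =
      W (q + r + s) * W (q - r) * W (q + d + s) * W (q + d) := by
  have h := net (q + d) q r s
  rw [rel, show q + d - q = d by ring, hd] at h
  linear_combination -h

end Ring

/-! ## Consequences of the shifted relations (`W 1 = 1`) -/

section Normalised

variable {R : Type u} [CommRing R] {W : ℤ → R}

/-- `W(d+p) W(d-p) = W(d+1) W(d-1) W(p)²` at a zero `d` of an odd elliptic net with `W 1 = 1`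
(`ER(p, d, 1, 0) = 0`). [folklore] -/
theorem rel_shift_one (net : IsEllipticNet W) (odd : Function.Odd W) (h1 : W 1 = 1) {d : ℤ}
    (hd : W d = 0) (p : ℤ) :
    W (d + p) * W (d - p) = W (d + 1) * W (d - 1) * W p ^ 2 := by
  have h := rel_shift net odd hd p 1 0
  have e1 : W (p + d + 0) = W (d + p) := by congr 1; ring
  have e2 : W (p - d) = -W (d - p) := by rw [← odd (d - p)]; congr 1; ring
  have e3 : W (1 + d + 0) = W (d + 1) := by congr 1; ring
  have e4 : W (1 - d) = -W (d - 1) := by rw [← odd (d - 1)]; congr 1; ring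
  rw [e1, e2, e3, e4, add_zero, add_zero, h1] at h
  linear_combination -h

/-- `W(d-1) W(k) W(j) W(d+n) = -W(d+j) W(d+k) W(n)` for `k + j = n - 1`, at a zero `d` of an odd
elliptic net with `W 1 = 1` (`ER(1, d, -k, n-1) = 0`). [folklore] -/
theorem rel_shift_add (net : IsEllipticNet W) (odd : Function.Odd W) (h1 : W 1 = 1) {d : ℤ}
    (hd : W d = 0) {k j n : ℤ} (hkj : k + j = n - 1) :
    W (d - 1) * W k * W j * W (d + n) = -(W (d + j) * W (d + k) * W n) := by
  have h := rel_shift net odd hd 1 (-k) (n - 1)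
  have e1 : W (1 + d + (n - 1)) = W (d + n) := by congr 1; ring
  have e2 : W (1 - d) = -W (d - 1) := by rw [← odd (d - 1)]; congr 1; ring
  have e3 : W (-k + (n - 1)) = W j := by congr 1; omega
  have e4 : W (-k + d + (n - 1)) = W (d + j) := by congr 1; omega
  have e5 : W (-k - d) = -W (d + k) := by rw [← odd (d + k)]; congr 1; ring
  have e6 : W (1 + (n - 1)) = W n := by congr 1; ring
  rw [e1, e2, e3, e4, e5, e6, odd k, h1] at h
  linear_combination h

/-- `W(d+1) W(k) W(j) W(d-n) = -W(d-j) W(d-k) W(n)` for `k + j = n - 1`, at a zero `d` of an odd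
elliptic net with `W 1 = 1` (`ER(-1, d, k, 1-n) = 0`). [folklore] -/
theorem rel_shift_sub (net : IsEllipticNet W) (odd : Function.Odd W) (h1 : W 1 = 1) {d : ℤ}
    (hd : W d = 0) {k j n : ℤ} (hkj : k + j = n - 1) :
    W (d + 1) * W k * W j * W (d - n) = -(W (d - j) * W (d - k) * W n) := by
  have h := rel_shift net odd hd (-1) k (1 - n)
  have e1 : W (-1 + d + (1 - n)) = W (d - n) := by congr 1; ring
  have e2 : W (-1 - d) = -W (d + 1) := by rw [← odd (d + 1)]; congr 1; ring
  have e3 : W (k + (1 - n)) = -W j := by rw [← odd j]; congr 1; omega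
  have e4 : W (k + d + (1 - n)) = W (d - j) := by congr 1; omega
  have e5 : W (k - d) = -W (d - k) := by rw [← odd (d - k)]; congr 1; ring
  have e6 : W (-1 + (1 - n)) = -W n := by rw [← odd n]; congr 1; ring
  rw [e1, e2, e3, e4, e5, e6, odd 1, h1] at h
  linear_combination h

/-- `W(d-1) W(d+3) = -W(d+1)² W(3)` at a zero `d` of an odd elliptic net with `W 1 = 1`
(`ER(d+1, 1, 2, 0) = 0`). [folklore] -/
theorem rel_shift'_three (net : IsEllipticNet W) (odd : Function.Odd W) (h1 : W 1 = 1) {d : ℤ}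
    (hd : W d = 0) : W (d - 1) * W (d + 3) = -(W (d + 1) ^ 2 * W 3) := by
  have h := rel_shift' net hd 1 2 0
  have e1 : W (1 + d + 2 + 0) = W (d + 3) := by congr 1; ring
  have e2 : W (1 + d - 2) = W (d - 1) := by congr 1; ring
  have e3 : W (1 + 2 + 0) = W 3 := by norm_num
  have e4 : W (1 - 2) = -W 1 := by rw [← odd 1]; norm_num
  have e5 : W (1 + d + 0) = W (d + 1) := by congr 1; ring
  have e6 : W (1 + d) = W (d + 1) := by congr 1; ring
  rw [e1, e2, e3, e4, e5, e6, show (1 : ℤ) + 0 = 1 by rfl, h1] at h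
  linear_combination h

/-- `W(3) W(d+2)² = W(2)² W(d+1) W(d+3)` at a zero `d` of an elliptic net with `W 1 = 1`
(`ER(d+1, 1, -1, 2) = 0`). [folklore] -/
theorem rel_shift'_two (net : IsEllipticNet W) (h1 : W 1 = 1) {d : ℤ} (hd : W d = 0) :
    W 3 * W (d + 2) ^ 2 = W 2 ^ 2 * W (d + 1) * W (d + 3) := by
  have h := rel_shift' net hd 1 (-1) 2
  have e1 : W (1 + d + -1 + 2) = W (d + 2) := by congr 1; ring
  have e2 : W (1 + d - -1) = W (d + 2) := by congr 1; ring
  have e3 : W (1 + 2) = W 3 := by norm_num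
  have e4 : W (1 + -1 + 2) = W 2 := by norm_num
  have e5 : W (1 - -1) = W 2 := by norm_num
  have e6 : W (1 + d + 2) = W (d + 3) := by congr 1; ring
  have e7 : W (1 + d) = W (d + 1) := by congr 1; ring
  rw [e1, e2, e3, e4, e5, e6, e7, h1] at h
  linear_combination h

end Normalised

/-! ## The degenerate case `W 2 = 0` -/

section Degenerate

variable {R : Type u} [CommRing R]

/-- For `b = 0` every even-indexed term of the normalised EDS `normEDS b c d` vanishes (each
carries the factor `b`). [folklore] -/
theorem normEDS_even_eq_zero (c d : R) (m : ℤ) : normEDS 0 c d (2 * m) = 0 := by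
  rw [normEDS, if_pos (even_two_mul m), mul_zero]

/-- For `b = 0` and `c ≠ 0` in a domain, no odd-indexed term of `normEDS b c d` vanishes: by the
odd recurrence `W(2m+1) = W(m+2) W(m)³ - W(m-1) W(m+1)³`, in which one of the two products has an
even-indexed factor, each odd-indexed term is `±` a product of earlier odd-indexed terms.
[folklore] -/
theorem normEDS_odd_ne_zero [IsDomain R] {c : R} (hc : c ≠ 0) (d : R) (m : ℤ) :
    normEDS 0 c d (2 * m + 1) ≠ 0 := by
  have hnat : ∀ m : ℕ, normEDS 0 c d (2 * (m : ℤ) + 1) ≠ 0 := by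
    intro m
    induction m using Nat.strong_induction_on with
    | _ m ih =>
      rcases Nat.lt_or_ge m 2 with hm | hm
      · interval_cases m
        · simp
        · simpa using hc
      have hrec := normEDS_odd (0 : R) c d (m : ℤ)
      rcases Nat.even_or_odd' m with ⟨s, rfl | rfl⟩
      · -- `m = 2s`, `s = t + 1`: `W(m) = 0`
        obtain ⟨t, rfl⟩ : ∃ t, s = t + 1 := ⟨s - 1, by omega⟩
        have e0 : normEDS 0 c d ((2 * (t + 1) : ℕ) : ℤ) = 0 := by
          rw [show ((2 * (t + 1) : ℕ) : ℤ) = 2 * ((t : ℤ) + 1) by push_cast; ring]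
          exact normEDS_even_eq_zero c d _
        have e1 : normEDS 0 c d (((2 * (t + 1) : ℕ) : ℤ) - 1) = normEDS 0 c d (2 * (t : ℤ) + 1) := by
          rw [show (((2 * (t + 1) : ℕ) : ℤ) - 1) = 2 * (t : ℤ) + 1 by omega]
        have e2 : normEDS 0 c d (((2 * (t + 1) : ℕ) : ℤ) + 1) =
            normEDS 0 c d (2 * ((t + 1 : ℕ) : ℤ) + 1) := by
          rw [show (((2 * (t + 1) : ℕ) : ℤ) + 1) = 2 * ((t + 1 : ℕ) : ℤ) + 1 by omega]
        rw [hrec, e0, e1, e2]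
        simpa using mul_ne_zero (ih t (by omega)) (pow_ne_zero 3 (ih (t + 1) (by omega)))
      · -- `m = 2s + 1`, `s = t + 1`: `W(m + 1) = 0`
        obtain ⟨t, rfl⟩ : ∃ t, s = t + 1 := ⟨s - 1, by omega⟩
        have e0 : normEDS 0 c d (((2 * (t + 1) + 1 : ℕ) : ℤ) + 1) = 0 := by
          rw [show ((2 * (t + 1) + 1 : ℕ) : ℤ) + 1 = 2 * ((t : ℤ) + 2) by push_cast; ring]
          exact normEDS_even_eq_zero c d _
        have e1 : normEDS 0 c d (((2 * (t + 1) + 1 : ℕ) : ℤ) + 2) =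
            normEDS 0 c d (2 * ((t + 2 : ℕ) : ℤ) + 1) := by
          rw [show (((2 * (t + 1) + 1 : ℕ) : ℤ) + 2) = 2 * ((t + 2 : ℕ) : ℤ) + 1 by omega]
        have e2 : normEDS 0 c d ((2 * (t + 1) + 1 : ℕ) : ℤ) =
            normEDS 0 c d (2 * ((t + 1 : ℕ) : ℤ) + 1) := by
          rw [show ((2 * (t + 1) + 1 : ℕ) : ℤ) = 2 * ((t + 1 : ℕ) : ℤ) + 1 by omega]
        rw [hrec, e0, e1, e2]
        simpa using mul_ne_zero (ih (t + 2) (by omega)) (pow_ne_zero 3 (ih (t + 1) (by omega)))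
  rcases Int.eq_nat_or_neg m with ⟨n, rfl | rfl⟩
  · exact hnat n
  · rcases n with _ | n
    · simp
    · rw [show 2 * -((n + 1 : ℕ) : ℤ) + 1 = -(2 * (n : ℤ) + 1) by push_cast; ring, normEDS_neg,
        neg_ne_zero]
      exact hnat n

/-- For `b = 0` and `c ≠ 0` in a domain, `normEDS b c d n = 0 ↔ n` is even. [folklore] -/
theorem normEDS_eq_zero_iff_even [IsDomain R] {c : R} (hc : c ≠ 0) (d : R) (n : ℤ) :
    normEDS 0 c d n = 0 ↔ Even n := by
  rcases Int.even_or_odd' n with ⟨m, rfl | rfl⟩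
  · exact ⟨fun _ => even_two_mul m, fun _ => normEDS_even_eq_zero c d m⟩
  · exact ⟨fun h => absurd h (normEDS_odd_ne_zero hc d m), fun h => absurd h (Int.not_even_two_mul_add_one m)⟩

end Degenerate

/-! ## The symmetry theorem -/

section Field

variable {K : Type u} [Field K] {W : ℤ → K}

/-- **Ward's symmetry theorem for elliptic nets over a field.** Let `W : ℤ → K` be an odd elliptic
net with `W 1 = 1`, and let `d ≥ 3` satisfy `W d = 0`, `W j ≠ 0` for `0 < j < d`, `W (d+1) ≠ 0`,
and `W 4 = -W 2 ^ 5` in case `d = 3`. Then there are `α, β ∈ Kˣ` with `α² = β^d` and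
`W (d + n) = α βⁿ W n` for every `n ∈ ℤ` (Ward: `W(ρ + n) = a^n b W(n)` with `b² = a^ρ`; here
`a = β`, `b = α`, `ρ = d`). [cite: SilvermanAEC2009, Exercise 3.35(f)] -/
theorem exists_periodic (net : IsEllipticNet W) (odd : Function.Odd W) (h1 : W 1 = 1) {d : ℤ}
    (hd3 : 3 ≤ d) (hd : W d = 0) (hne : ∀ j : ℤ, 0 < j → j < d → W j ≠ 0) (hu : W (d + 1) ≠ 0)
    (h3 : d = 3 → W 4 = -W 2 ^ 5) :
    ∃ α β : K, α ≠ 0 ∧ β ≠ 0 ∧ α ^ 2 = β ^ d ∧ ∀ n : ℤ, W (d + n) = α * β ^ n * W n := by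
  -- basic nonvanishing facts
  have h0 : W 0 = 0 := apply_zero_eq_zero net
  have hv : W (d - 1) ≠ 0 := hne (d - 1) (by omega) (by omega)
  have hb : W 2 ≠ 0 := hne 2 (by norm_num) (by omega)
  have hd2 : W (d - 2) ≠ 0 := hne (d - 2) (by omega) (by omega)
  have hN := rel_shift_one net odd h1 hd
  -- (i)  `W(d+2) W(d-2) = W(d+1) W(d-1) W(2)²`
  have hi : W (d + 2) * W (d - 2) = W (d + 1) * W (d - 1) * W 2 ^ 2 := hN 2
  have hw : W (d + 2) ≠ 0 := by
    intro hw0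
    rw [hw0, zero_mul] at hi
    exact mul_ne_zero (mul_ne_zero hu hv) (pow_ne_zero 2 hb) hi.symm
  -- (†)  `W(d-1) W(d+2)² = -W(d+1)³ W(2)²`
  have hdag : W (d - 1) * W (d + 2) ^ 2 = -(W (d + 1) ^ 3 * W 2 ^ 2) := by
    rcases eq_or_lt_of_le hd3 with h3' | h4
    · -- `d = 3`
      have hd3' : d = 3 := h3'.symm
      have hu5 : W (d + 1) = -W 2 ^ 5 := by rw [hd3']; exact h3 hd3'
      have hvb : W (d - 1) = W 2 := by rw [hd3']; norm_num
      have hw' : W (d + 2) = W (d + 1) * W (d - 1) * W 2 ^ 2 := by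
        rw [← hi, hd3', show (3 : ℤ) - 2 = 1 by norm_num, h1, mul_one]
      rw [hw', hvb, hu5]
      ring
    · -- `d ≥ 4`: cancel `W 3 ≠ 0`
      have hW3 : W 3 ≠ 0 := hne 3 (by norm_num) (by omega)
      have e1 := rel_shift'_three net odd h1 hd
      have e2 := rel_shift'_two net h1 hd
      have e3 : W 3 * (W (d - 1) * W (d + 2) ^ 2) = W 3 * -(W (d + 1) ^ 3 * W 2 ^ 2) := by
        linear_combination W (d - 1) * e2 + W 2 ^ 2 * W (d + 1) * e1
      exact mul_left_cancel₀ hW3 e3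
  -- the constants: `β W(d+1) W(2) = W(d+2)`, `α W(d+2) = W(d+1)² W(2)`
  obtain ⟨β, hβ⟩ : ∃ β : K, β * (W (d + 1) * W 2) = W (d + 2) :=
    ⟨W (d + 2) / (W (d + 1) * W 2), div_mul_cancel₀ _ (mul_ne_zero hu hb)⟩
  obtain ⟨α, hα⟩ : ∃ α : K, α * W (d + 2) = W (d + 1) ^ 2 * W 2 :=
    ⟨W (d + 1) ^ 2 * W 2 / W (d + 2), div_mul_cancel₀ _ hw⟩
  have hβ0 : β ≠ 0 := by
    rintro rfl
    rw [zero_mul] at hβ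
    exact hw hβ.symm
  have hα0 : α ≠ 0 := by
    rintro rfl
    rw [zero_mul] at hα
    exact mul_ne_zero (pow_ne_zero 2 hu) hb hα.symm
  -- (a) `α β = W(d+1)`  (b) `α β² W(2) = W(d+2)`  (c) `α = -W(d-1) β`
  have ha : α * β = W (d + 1) := by
    have e : (α * β - W (d + 1)) * W (d + 2) = 0 := by
      linear_combination β * hα + W (d + 1) * hβ
    exact sub_eq_zero.mp ((mul_eq_zero.mp e).resolve_right hw)
  have hbb : α * β ^ 2 * W 2 = W (d + 2) := by linear_combination β * W 2 * ha + hβ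
  have hc : α = -(W (d - 1) * β) := by
    have e : (α + W (d - 1) * β) * (W (d + 2) * (W (d + 1) * W 2)) = 0 := by
      linear_combination (W (d + 1) * W 2) * hα + (W (d - 1) * W (d + 2)) * hβ + hdag
    exact eq_neg_of_add_eq_zero_left
      ((mul_eq_zero.mp e).resolve_right (mul_ne_zero hw (mul_ne_zero hu hb)))
  have hE : ∀ k j n : ℤ, k + j = n - 1 →
      W (d - 1) * W k * W j * W (d + n) = -(W (d + j) * W (d + k) * W n) :=
    fun k j n hkj => rel_shift_add net odd h1 hd hkj
  have hE' : ∀ k j n : ℤ, k + j = n - 1 →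
      W (d + 1) * W k * W j * W (d - n) = -(W (d - j) * W (d - k) * W n) :=
    fun k j n hkj => rel_shift_sub net odd h1 hd hkj
  have hdpos : (0 : ℤ) < d := by omega
  -- no two consecutive naturals are multiples of `d`
  have hcons : ∀ m : ℕ, d ∣ (m : ℤ) → d ∣ ((m + 1 : ℕ) : ℤ) → False := by
    rintro m ⟨c0, hc0⟩ ⟨c1, hc1⟩
    have h1d : d ∣ (1 : ℤ) := ⟨c1 - c0, by rw [mul_sub, ← hc0, ← hc1]; push_cast; ring⟩
    have := Int.eq_one_of_dvd_one hdpos.le h1d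
    omega
  -- S⁺ : `W(d+n) = α βⁿ W(n)` for `n ≥ 0`, together with the zero set below `d + n`
  have hS : ∀ n : ℕ, W (d + n) = α * β ^ n * W n ∧ (W n = 0 → d ∣ (n : ℤ)) := by
    intro n
    induction n using Nat.strong_induction_on with
    | _ n ih =>
      have hz : ∀ m : ℕ, m ≤ n → W m = 0 → d ∣ (m : ℤ) := by
        intro m hmn hm0
        rcases lt_trichotomy (m : ℤ) d with hlt | heq | hgt
        · rcases Nat.eq_zero_or_pos m with rfl | hmpos
          · exact dvd_zero d
          · exact absurd hm0 (hne m (by exact_mod_cast hmpos) hlt)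
        · exact heq ▸ dvd_rfl
        · obtain ⟨m', hm'⟩ : ∃ m' : ℕ, (m : ℤ) = d + m' := ⟨(m - d).toNat, by omega⟩
          have hm'lt : m' < n := by omega
          have h' := (ih m' hm'lt).1
          rw [← hm', hm0] at h'
          have hWm' : W m' = 0 := by
            rcases mul_eq_zero.mp h'.symm with h'' | h''
            · exact absurd h'' (mul_ne_zero hα0 (pow_ne_zero _ hβ0))
            · exact h''
          obtain ⟨c, hc'⟩ := (ih m' hm'lt).2 hWm'
          exact ⟨c + 1, by rw [hm', hc']; ring⟩
      refine ⟨?_, hz n le_rfl⟩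
      rcases Nat.lt_or_ge n 3 with hn3 | hn3
      · interval_cases n
        · simp [hd, h0]
        · simp [h1, ha]
        · push_cast
          exact hbb.symm
      obtain ⟨m, rfl⟩ : ∃ m, n = m + 3 := ⟨n - 3, by omega⟩
      -- pick `(k, j) = (1, m + 1)` or `(2, m)` with `W k, W j ≠ 0`
      have step : ∀ k j : ℕ, k + j = m + 2 → W k ≠ 0 → W j ≠ 0 →
          W (d + ((m + 3 : ℕ) : ℤ)) = α * β ^ (m + 3) * W ((m + 3 : ℕ) : ℤ) := by
        intro k j hkj hk hj
        have e := hE k j ((m + 3 : ℕ) : ℤ) (by push_cast; omega)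
        have ej := (ih j (by omega)).1
        have ek := (ih k (by omega)).1
        have hβn : β ^ (m + 3) = β ^ j * β ^ k * β := by
          rw [← pow_add, ← pow_succ]; congr 1; omega
        apply mul_left_cancel₀ (mul_ne_zero (mul_ne_zero hv hk) hj)
        rw [hβn]
        linear_combination e - (W (d + (k : ℤ)) * W ((m + 3 : ℕ) : ℤ)) * ej
          - (α * β ^ j * W (j : ℤ) * W ((m + 3 : ℕ) : ℤ)) * ek
          - (α * β ^ j * β ^ k * W (j : ℤ) * W (k : ℤ) * W ((m + 3 : ℕ) : ℤ)) * hc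
      by_cases hm1 : W ((m + 1 : ℕ) : ℤ) = 0
      · have hm0 : W (m : ℕ) ≠ 0 := fun hm0 =>
          hcons m (hz m (by omega) hm0) (hz (m + 1) (by omega) hm1)
        exact step 2 m (by omega) (by exact_mod_cast hb) hm0
      · exact step 1 (m + 1) (by omega) (by exact_mod_cast (h1.symm ▸ one_ne_zero)) hm1
  have hzero : ∀ m : ℕ, W m = 0 → d ∣ (m : ℤ) := fun m => (hS m).2
  -- S⁻ : `W(d-n) βⁿ = -α W(n)` for `n ≥ 0`
  have hS' : ∀ n : ℕ, W (d - n) * β ^ n = -(α * W n) := by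
    intro n
    induction n using Nat.strong_induction_on with
    | _ n ih =>
      rcases Nat.lt_or_ge n 3 with hn3 | hn3
      · interval_cases n
        · simp [hd, h0]
        · simp [h1, hc]
        · push_cast
          apply mul_left_cancel₀ (mul_ne_zero hα0 hb)
          linear_combination W (d - 2) * hbb + hi - (W (d - 1) * W 2 ^ 2) * ha
            + (α * W 2 ^ 2) * hc
      obtain ⟨m, rfl⟩ : ∃ m, n = m + 3 := ⟨n - 3, by omega⟩
      have step : ∀ k j : ℕ, k + j = m + 2 → W k ≠ 0 → W j ≠ 0 →
          W (d - ((m + 3 : ℕ) : ℤ)) * β ^ (m + 3) = -(α * W ((m + 3 : ℕ) : ℤ)) := by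
        intro k j hkj hk hj
        have e := hE' k j ((m + 3 : ℕ) : ℤ) (by push_cast; omega)
        have ej := ih j (by omega)
        have ek := ih k (by omega)
        have hβn : β ^ (m + 3) = β ^ j * β ^ k * β := by
          rw [← pow_add, ← pow_succ]; congr 1; omega
        apply mul_left_cancel₀ (mul_ne_zero (mul_ne_zero hu hk) hj)
        rw [hβn]
        linear_combination (β ^ j * β ^ k * β) * e
          - (W (d - (k : ℤ)) * W ((m + 3 : ℕ) : ℤ) * β ^ k * β) * ej
          + (α * W (j : ℤ) * W ((m + 3 : ℕ) : ℤ) * β) * ek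
          - (α * W (j : ℤ) * W (k : ℤ) * W ((m + 3 : ℕ) : ℤ)) * ha
      by_cases hm1 : W ((m + 1 : ℕ) : ℤ) = 0
      · have hm0 : W (m : ℕ) ≠ 0 := fun hm0 =>
          hcons m (hzero m hm0) (hzero (m + 1) hm1)
        exact step 2 m (by omega) (by exact_mod_cast hb) hm0
      · exact step 1 (m + 1) (by omega) (by exact_mod_cast (h1.symm ▸ one_ne_zero)) hm1
  -- `α² = β^d` from `W(2d+1) = -W(d+1)³ W(d-1)`
  obtain ⟨dn, hdn⟩ : ∃ dn : ℕ, (dn : ℤ) = d := ⟨d.toNat, by omega⟩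
  have hsq : α ^ 2 = β ^ d := by
    have e1 := (hS (dn + 1)).1
    have e2 := hN (d + 1)
    rw [show ((dn + 1 : ℕ) : ℤ) = d + 1 by push_cast; omega] at e1
    rw [show d - (d + 1) = -1 by ring, odd 1, h1, e1] at e2
    -- e2 : α * β ^ (dn + 1) * W (d + 1) * -W 1 = W (d + 1) * W (d - 1) * W (d + 1) ^ 2
    have e3 : α ^ 2 * β ^ 2 * (β ^ dn - α ^ 2) = 0 := by
      linear_combination (-1 : K) * e2
        + (α * β ^ (dn + 1) + W (d - 1) * (α ^ 2 * β ^ 2 + α * β * W (d + 1) + W (d + 1) ^ 2)) * ha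
        - (α ^ 3 * β ^ 2) * hc
    rw [← hdn, zpow_natCast]
    exact (sub_eq_zero.mp ((mul_eq_zero.mp e3).resolve_left
      (mul_ne_zero (pow_ne_zero 2 hα0) (pow_ne_zero 2 hβ0)))).symm
  refine ⟨α, β, hα0, hβ0, hsq, fun n => ?_⟩
  rcases Int.eq_nat_or_neg n with ⟨m, rfl | rfl⟩
  · rw [zpow_natCast]
    exact (hS m).1
  · have e := hS' m
    rw [show d + -(m : ℤ) = d - m by ring, odd m, zpow_neg, zpow_natCast]
    field_simp
    linear_combination e

end Field

end EllipticNet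

end Literature.NumberTheory.EllipticCurves
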